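import Mathlib.Analysis.SpecialFunctions.Complex.LogBounds
import Mathlib.Algebra.Order.Antidiag.Prod
import Literature.Analysis.Toeplitz.SzegoCommutator
import HarnessLib

/-!
# The strong Szegő limit theorem for symbols with geometrically decaying logarithm

Topic `Analysis/Toeplitz`, namespace `Literature.Analysis.Toeplitz`. We prove the strong Szegő
limit theorem (Deift–Its–Krasovsky 2013, §3, Theorem 7 / eq. (31); G. Szegő 1952, M. Kac 1954,
G. Baxter 1963 for complex symbols of zero winding, H. Widom 1976, E. Basor–J. W. Helton 1980) in
the case needed for the Ising model:

**Theorem (`strongSzego_geometric`).** Let `V : ℝ → ℂ` be continuous, `2π`-periodic, with Fourier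
coefficients `V_k = circleCoeff V k` satisfying `‖V_k‖ ≤ C r^{|k|}` for some `0 ≤ r < 1`. Then

  `D_n(e^V) / e^{n V₀} → exp (∑_{k ≥ 1} k V_k V_{-k})`   (`n → ∞`),

with `D_n(e^V) = toeplitzDet (circleCoeff (exp ∘ V)) n` — literally the conclusion of the tree's
named fact `Literature.Analysis.Toeplitz.strongSzego` (DIK Theorem 7, there for all continuous `V`
with `∑ |k| |V_k|² < ∞`), for the subclass of geometrically decaying coefficients.

## Proof (Basor–Helton / Widom, with an elementary evaluation of the constant)

By `SzegoCommutator.tendsto_toeplitzDet_div`, `D_n(e^V)/e^{nV₀} → f 1 1`, where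
`f s t = det {T(φ₊^s)⁻¹, T(φ₋^t)}` is the von Koch determinant of the Basor–Helton commutator, a
BICHARACTER in `(s, t)` (`f_add_left`, `f_add_right`), so `f 1 1 = f(2^{-m}, 2^{-m})^{4^m}` for
all `m`. The Helton–Howe–Pincus evaluation `det (e^A e^B e^{-A} e^{-B}) = e^{tr [A,B]}` is replaced
by the second-order expansion **`f ε ε = 1 + ε² κ + O(ε³)`** (`norm_f_sub_le`), where
`κ = tr H(V₊)H(Ṽ₋) = ∑_{k≥1} k V_k V_{-k}` (`ctrace_hankelT_eq_kappa`), obtained from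
`det (1 + K) = 1 + tr K + O(‖K‖²)` (`KochDeterminant`) and `K ε ε = ε² H(a₊)H(a₋) + O(ε³)`; hence
`f 1 1 = lim (1 + 4^{-m} κ + O(8^{-m}))^{4^m} = e^κ` (`tendsto_pow_exp_of_tendsto`).

## References

* P. Deift, A. Its, I. Krasovsky, Comm. Pure Appl. Math. 66 (2013) 1360–1438, §3, Thm. 7 and the
  discussion of the Basor–Helton and Widom proofs.
* E. Basor, J. W. Helton, J. Operator Theory 3 (1980) 23–39.
* H. Widom, Adv. Math. 21 (1976) 1–29.
-/

noncomputable section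

open Finset Filter Complex Matrix
open scoped _root_.Topology BigOperators Real

namespace Literature.Analysis.Toeplitz

/-! ### Bilinearity of the Hankel product; linearity of the trace -/

section Hankel

variable {r D D' D'' : ℝ} {a a' c c' : ℕ → ℂ}

/-- `hankelT` is additive in the first argument (geometric sequences). [folklore] -/
theorem hankelT_add_left (ha : IsGeom r D a) (ha' : IsGeom r D' a') (hc : IsGeom r D'' c) (hr : 0 ≤ r)
    (hr1 : r < 1) : hankelT (a + a') c = hankelT a c + hankelT a' c := by
  ext i j
  simp only [hankelT_apply, Matrix.add_apply, Pi.add_apply, add_mul]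
  exact (summable_hankelT ha hc hr hr1 i j).tsum_add (summable_hankelT ha' hc hr hr1 i j)

/-- `hankelT` is additive in the second argument (geometric sequences). [folklore] -/
theorem hankelT_add_right (ha : IsGeom r D a) (hc : IsGeom r D' c) (hc' : IsGeom r D'' c') (hr : 0 ≤ r)
    (hr1 : r < 1) : hankelT a (c + c') = hankelT a c + hankelT a c' := by
  ext i j
  simp only [hankelT_apply, Matrix.add_apply, Pi.add_apply, mul_add]
  exact (summable_hankelT ha hc hr hr1 i j).tsum_add (summable_hankelT ha hc' hr hr1 i j)

/-- `hankelT` is homogeneous in the first argument. [folklore] -/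
theorem hankelT_smul_left (t : ℂ) (a c : ℕ → ℂ) : hankelT (t • a) c = t • hankelT a c := by
  ext i j
  simp only [hankelT_apply, Matrix.smul_apply, Pi.smul_apply, smul_eq_mul, mul_assoc]
  exact tsum_mul_left

/-- `hankelT` is homogeneous in the second argument. [folklore] -/
theorem hankelT_smul_right (t : ℂ) (a c : ℕ → ℂ) : hankelT a (t • c) = t • hankelT a c := by
  ext i j
  simp only [hankelT_apply, Matrix.smul_apply, Pi.smul_apply, smul_eq_mul]
  rw [← tsum_mul_left]
  exact tsum_congr fun p => by ring

/-- The trace is additive on corner kernels. [folklore] -/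
theorem ctrace_add {ρ C D : ℝ} {K L : Matrix ℕ ℕ ℂ} (hK : IsCorner ρ C K) (hL : IsCorner ρ D L) (hρ : 0 ≤ ρ)
    (hρ1 : ρ < 1) : ctrace (K + L) = ctrace K + ctrace L := by
  simp only [ctrace, Matrix.add_apply]
  exact (hK.summable_norm_diag hρ hρ1).of_norm.tsum_add (hL.summable_norm_diag hρ hρ1).of_norm

/-- The trace is homogeneous. [folklore] -/
theorem ctrace_smul (t : ℂ) (K : Matrix ℕ ℕ ℂ) : ctrace (t • K) = t * ctrace K := by
  simp only [ctrace, Matrix.smul_apply, smul_eq_mul]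
  exact tsum_mul_left

/-- The trace is subtractive on corner kernels. [folklore] -/
theorem ctrace_sub {ρ C D : ℝ} {K L : Matrix ℕ ℕ ℂ} (hK : IsCorner ρ C K) (hL : IsCorner ρ D L) (hρ : 0 ≤ ρ)
    (hρ1 : ρ < 1) : ctrace (K - L) = ctrace K - ctrace L := by
  simp only [ctrace, Matrix.sub_apply]
  exact (hK.summable_norm_diag hρ hρ1).of_norm.tsum_sub (hL.summable_norm_diag hρ hρ1).of_norm

end Hankel

/-! ### The trace of `H(a₊) H(a₋)` is `∑ k v_k v_{-k}` -/

section Kappa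

variable {r D D' : ℝ} {a c : ℕ → ℂ}

/-- **`tr hankelT a c = ∑_{n} (n+1) a (n+1) c (n+1)`**: the double series `∑_{i,p} a (i+p+1) c (i+p+1)`
regrouped along the antidiagonals `i + p = n` (each value `a (n+1) c (n+1)` occurs `n+1` times). [folklore] -/
theorem hasSum_ctrace_hankelT (ha : IsGeom r D a) (hc : IsGeom r D' c) (hr : 0 ≤ r) (hr1 : r < 1) :
    HasSum (fun n : ℕ => ((n : ℂ) + 1) * (a (n + 1) * c (n + 1))) (ctrace (hankelT a c)) := by
  -- the double family is summable
  set F : ℕ × ℕ → ℂ := fun p => a (p.1 + p.2 + 1) * c (p.1 + p.2 + 1) with hF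
  have hFs : Summable F := by
    refine Summable.of_norm ?_
    rw [summable_prod_of_nonneg (fun p => norm_nonneg _)]
    have hr2 : r ^ 2 < 1 := pow_lt_one₀ hr hr1 two_ne_zero
    have hgeo := summable_geometric_of_lt_one (pow_nonneg hr 2) hr2
    have hle : ∀ i p : ℕ, ‖F (i, p)‖ ≤ D * D' * r ^ 2 * (r ^ 2) ^ i * (r ^ 2) ^ p := by
      intro i p
      rw [hF]; simp only
      rw [norm_mul]
      calc ‖a (i + p + 1)‖ * ‖c (i + p + 1)‖ ≤ D * r ^ (i + p + 1) * (D' * r ^ (i + p + 1)) :=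
            mul_le_mul (ha _) (hc _) (norm_nonneg _) (mul_nonneg ha.nonneg (pow_nonneg hr _))
        _ = D * D' * r ^ 2 * (r ^ 2) ^ i * (r ^ 2) ^ p := by
            rw [← pow_mul, ← pow_mul]; ring
    constructor
    · intro i
      exact Summable.of_nonneg_of_le (fun p => norm_nonneg _) (fun p => hle i p) (hgeo.mul_left _)
    · refine Summable.of_nonneg_of_le (fun i => tsum_nonneg fun p => norm_nonneg _) (fun i => ?_)
        (hgeo.mul_left (D * D' * r ^ 2 * (1 - r ^ 2)⁻¹))
      calc ∑' p, ‖F (i, p)‖ ≤ ∑' p, D * D' * r ^ 2 * (r ^ 2) ^ i * (r ^ 2) ^ p :=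
            (Summable.of_nonneg_of_le (fun p => norm_nonneg _) (fun p => hle i p) (hgeo.mul_left _)).tsum_le_tsum
              (fun p => hle i p) (hgeo.mul_left _)
        _ = D * D' * r ^ 2 * (1 - r ^ 2)⁻¹ * (r ^ 2) ^ i := by
            rw [tsum_mul_left, tsum_geometric_of_lt_one (pow_nonneg hr 2) hr2]; ring
  -- its sum is the trace
  have htrace : HasSum F (ctrace (hankelT a c)) := by
    have h2 : ctrace (hankelT a c) = ∑' p, F p := by rw [hFs.tsum_prod]; rfl
    rw [h2]; exact hFs.hasSum
  -- regroup along antidiagonals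
  set e := (Finset.HasAntidiagonal.sigmaAntidiagonalEquivProd (A := ℕ)) with he
  have hsig : HasSum (F ∘ e) (ctrace (hankelT a c)) := (Equiv.hasSum_iff e).2 htrace
  refine hsig.sigma fun n => ?_
  have hfin : HasSum (fun q : (antidiagonal n : Finset (ℕ × ℕ)) => (F ∘ e) ⟨n, q⟩)
      (∑ q : (antidiagonal n : Finset (ℕ × ℕ)), (F ∘ e) ⟨n, q⟩) := hasSum_fintype _
  have hval : ∀ q : (antidiagonal n : Finset (ℕ × ℕ)), (F ∘ e) ⟨n, q⟩ = a (n + 1) * c (n + 1) := by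
    intro q
    have hq := Finset.HasAntidiagonal.mem_antidiagonal.1 q.2
    simp only [Function.comp_apply, he, Finset.HasAntidiagonal.sigmaAntidiagonalEquivProd, Equiv.coe_fn_mk, hF]
    rw [hq]
  have hsumval : ∑ q : (antidiagonal n : Finset (ℕ × ℕ)), (F ∘ e) ⟨n, q⟩ =
      ((n : ℂ) + 1) * (a (n + 1) * c (n + 1)) := by
    rw [Finset.sum_congr rfl (fun q _ => hval q), Finset.sum_const, Finset.card_univ, Fintype.card_coe,
      Finset.Nat.card_antidiagonal, nsmul_eq_mul]
    push_cast; ring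
  rw [hsumval] at hfin
  exact hfin

end Kappa

namespace Szego

/-- **The Szegő exponent** `κ(V) = ∑_{k ≥ 1} k V_k V_{-k}`, in the indexing of the tree's `strongSzego`. [folklore] -/
def kappa (V : ℝ → ℂ) : ℂ :=
  ∑' k : ℕ, ((k : ℂ) + 1) * circleCoeff V ((k : ℤ) + 1) * circleCoeff V (-((k : ℤ) + 1))

section Expansion

variable {V : ℝ → ℂ} {Cv r : ℝ}

/-- **`tr H(a₊) H(a₋) = κ(V)`.** [folklore] -/
theorem ctrace_hankelT_eq_kappa (h : IsGeomSymbol V Cv r) : ctrace (hankelT (aPos V) (aNeg V)) = kappa V := by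
  have hs := hasSum_ctrace_hankelT ((isSumW_aPos h).isGeom (sig_pos h)) ((isSumW_aNeg h).isGeom (sig_pos h))
    (sig_pos h).le (sig_lt_one h)
  rw [← hs.tsum_eq, kappa]
  refine tsum_congr fun k => ?_
  rw [aPos, aNeg, posSeq_of_ne_zero _ (Nat.succ_ne_zero k), negSeq_of_ne_zero _ (Nat.succ_ne_zero k)]
  push_cast; ring

/-! ### The second-order expansion `f ε ε = 1 + ε² κ + O(ε³)` -/

/-- For real `0 ≤ ε` with `ε w ≤ 1` (`w ≥ 0`): `e^{εw} - 1 ≤ 2 ε w`. [folklore] -/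
theorem exp_sub_one_le {ε w : ℝ} (hε : 0 ≤ ε) (hw : 0 ≤ w) (h1 : ε * w ≤ 1) :
    Real.exp (ε * w) - 1 ≤ 2 * (ε * w) := by
  have h := Real.abs_exp_sub_one_le (x := ε * w) (by rw [abs_of_nonneg (mul_nonneg hε hw)]; exact h1)
  rw [abs_of_nonneg (mul_nonneg hε hw)] at h
  exact (le_abs_self _).trans h

/-- For real `0 ≤ ε` with `ε w ≤ 1` (`w ≥ 0`): `e^{εw} - 1 - εw ≤ (ε w)²`. [folklore] -/
theorem exp_sub_one_sub_le {ε w : ℝ} (hε : 0 ≤ ε) (hw : 0 ≤ w) (h1 : ε * w ≤ 1) :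
    Real.exp (ε * w) - 1 - ε * w ≤ (ε * w) ^ 2 := by
  have h := Real.abs_exp_sub_one_sub_id_le (x := ε * w) (by rw [abs_of_nonneg (mul_nonneg hε hw)]; exact h1)
  exact (le_abs_self _).trans h

/-- The norm of a real scalar `ε ≥ 0` in `ℂ`. [folklore] -/
theorem norm_ofReal_of_nonneg {ε : ℝ} (hε : 0 ≤ ε) : ‖(ε : ℂ)‖ = ε := by
  rw [Complex.norm_real, Real.norm_of_nonneg hε]

/-- The Hankel factor `c = σ²/(1-σ²)`. [folklore] -/
def hfac (r : ℝ) : ℝ := sig r ^ 2 / (1 - sig r ^ 2)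

/-- `0 ≤ hfac`. [folklore] -/
theorem hfac_nonneg (h : IsGeomSymbol V Cv r) : 0 ≤ hfac r := by
  have h1 : sig r ^ 2 < 1 := pow_lt_one₀ (sig_pos h).le (sig_lt_one h) two_ne_zero
  exact div_nonneg (sq_nonneg _) (by linarith)

/-- `isCorner_hankelT` with the factor `hfac`, transported to rate `τ`. [folklore] -/
theorem isCorner_hankelT_tau (h : IsGeomSymbol V Cv r) {D D' : ℝ} {a c : ℕ → ℂ} (ha : IsGeom (sig r) D a)
    (hc : IsGeom (sig r) D' c) : IsCorner (tau r) (D * D' * hfac r) (hankelT a c) := by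
  have := isCorner_hankelT_of_le ha hc (sig_pos h).le (sig_lt_one h) (sig_lt_tau h).le
  rwa [show D * D' * sig r ^ 2 / (1 - sig r ^ 2) = D * D' * hfac r by rw [hfac]; ring] at this

/-- The constant `c₂ = 4 w₊ w₋ hfac` of `Hk ε ε = O(ε²)`. [folklore] -/
def c2 (V : ℝ → ℂ) (r : ℝ) : ℝ := 4 * wP V r * wN V r * hfac r

/-- The constant `c₁` of `Hk ε ε - ε² H₀ = O(ε³)`. [folklore] -/
def c1 (V : ℝ → ℂ) (r : ℝ) : ℝ :=
  (wP V r * wN V r ^ 2 + wP V r ^ 2 * wN V r + wP V r ^ 2 * wN V r ^ 2) * hfac r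

/-- The constant `c₄` of `K ε ε = O(ε²)`. [folklore] -/
def c4 (V : ℝ → ℂ) (r : ℝ) : ℝ :=
  c2 V r * (1 + 2 * wP V r * gconst r + 2 * wN V r * gconst r + 4 * wP V r * wN V r * gconst r ^ 2)

/-- The constant `c₃` of `K ε ε - ε² H₀ = O(ε³)`. [folklore] -/
def c3 (V : ℝ → ℂ) (r : ℝ) : ℝ :=
  c1 V r + c2 V r * (2 * wP V r * gconst r + 2 * wN V r * gconst r + 4 * wP V r * wN V r * gconst r ^ 2)

/-- The admissible range of `ε`. [folklore] -/
def eps0 (V : ℝ → ℂ) (r : ℝ) : ℝ := min 1 (min (1 / (wP V r + wN V r + 1)) (1 / (c4 V r + 1)))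

/-- The final constant of the expansion. [folklore] -/
def Acst (V : ℝ → ℂ) (r : ℝ) : ℝ :=
  kochConst (tau r) 1 * (∑' S, kochWeight (tau r) S) * c4 V r ^ 2 + c3 V r / (1 - tau r ^ 2)

/-- `0 ≤ c₂`. [folklore] -/
theorem c2_nonneg (h : IsGeomSymbol V Cv r) : 0 ≤ c2 V r :=
  mul_nonneg (mul_nonneg (mul_nonneg (by norm_num) (wP_nonneg h)) (wN_nonneg h)) (hfac_nonneg h)

/-- `0 ≤ c₄`. [folklore] -/
theorem c4_nonneg (h : IsGeomSymbol V Cv r) : 0 ≤ c4 V r := by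
  have := wP_nonneg h; have := wN_nonneg h; have := gconst_nonneg h; have := c2_nonneg h
  unfold c4; positivity

/-- `0 < eps0`. [folklore] -/
theorem eps0_pos (h : IsGeomSymbol V Cv r) : 0 < eps0 V r := by
  have := wP_nonneg h; have := wN_nonneg h; have := c4_nonneg h
  unfold eps0
  refine lt_min one_pos (lt_min ?_ ?_) <;> positivity

variable [Fact (0 ≤ r)] [Fact (r < 1)]

attribute [local instance] fact_tau_pos fact_tau_lt_one

/-- **`K ε ε = ε² H(a₊)H(a₋) + O(ε³)` and `K ε ε = O(ε²)`**: for real `0 ≤ ε ≤ eps0`, the kernel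
`K ε ε` is a corner kernel with constant `c₄ ε²`, and `K ε ε - ε² hankelT a₊ a₋` one with constant
`c₃ ε³`. [folklore] -/
theorem isCorner_K_eps (h : IsGeomSymbol V Cv r) {ε : ℝ} (hε : 0 ≤ ε) (hε0 : ε ≤ eps0 V r) :
    IsCorner (tau r) (c4 V r * ε ^ 2) (K h ε ε) ∧
      IsCorner (tau r) (c3 V r * ε ^ 3) (K h ε ε - ((ε : ℂ) ^ 2) • hankelT (aPos V) (aNeg V)) := by
  have hτ := (tau_pos h).le; have hτ1 := tau_lt_one h
  have hσ := sig_pos h; have hσ1 := sig_lt_one h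
  have hwP := wP_nonneg h; have hwN := wN_nonneg h; have hg := gconst_nonneg h; have hhf := hfac_nonneg h
  -- the range of `ε`
  have hε1 : ε ≤ 1 := hε0.trans (min_le_left _ _)
  have hεw : ε * (wP V r + wN V r + 1) ≤ 1 := by
    have h2 : ε ≤ 1 / (wP V r + wN V r + 1) := hε0.trans ((min_le_right _ _).trans (min_le_left _ _))
    rwa [le_div_iff₀ (by positivity)] at h2
  have hεP : ε * wP V r ≤ 1 := by nlinarith
  have hεN : ε * wN V r ≤ 1 := by nlinarith
  -- the sequences `u = eP ε - δ`, `u' = eN ε - δ` and the remainders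
  have hnorm : ‖(ε : ℂ)‖ = ε := norm_ofReal_of_nonneg hε
  have hnormn : ‖(-(ε : ℂ))‖ = ε := by rw [norm_neg, hnorm]
  have hu : IsGeom (sig r) (2 * (ε * wP V r)) (eP V ε - delta) := by
    have h1 := isGeom_expSeq_sub_delta ((isSumW_aPos h).smul (ε : ℂ)) hσ
    rw [wn_smul, hnorm] at h1
    exact h1.mono hσ.le (exp_sub_one_le hε hwP hεP)
  have hu' : IsGeom (sig r) (2 * (ε * wN V r)) (eN V ε - delta) := by
    have h1 := isGeom_expSeq_sub_delta ((isSumW_aNeg h).smul (ε : ℂ)) hσ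
    rw [wn_smul, hnorm] at h1
    exact h1.mono hσ.le (exp_sub_one_le hε hwN hεN)
  have hR : IsGeom (sig r) ((ε * wP V r) ^ 2) (eP V ε - delta - (ε : ℂ) • aPos V) := by
    have h1 := isGeom_expSeq_sub_delta_sub ((isSumW_aPos h).smul (ε : ℂ)) hσ
    rw [wn_smul, hnorm] at h1
    exact h1.mono hσ.le (exp_sub_one_sub_le hε hwP hεP)
  have hR' : IsGeom (sig r) ((ε * wN V r) ^ 2) (eN V ε - delta - (ε : ℂ) • aNeg V) := by
    have h1 := isGeom_expSeq_sub_delta_sub ((isSumW_aNeg h).smul (ε : ℂ)) hσ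
    rw [wn_smul, hnorm] at h1
    exact h1.mono hσ.le (exp_sub_one_sub_le hε hwN hεN)
  have haP : IsGeom (sig r) (wP V r) (aPos V) := (isSumW_aPos h).isGeom hσ
  have haN : IsGeom (sig r) (wN V r) (aNeg V) := (isSumW_aNeg h).isGeom hσ
  have hεaP : IsGeom (sig r) (ε * wP V r) ((ε : ℂ) • aPos V) := by
    have := haP.smul (ε : ℂ); rwa [hnorm] at this
  have hεaN : IsGeom (sig r) (ε * wN V r) ((ε : ℂ) • aNeg V) := by
    have := haN.smul (ε : ℂ); rwa [hnorm] at this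
  -- `H = hankelT u u' = ε² H₀ + (ε H(a₊, Rn) + ε H(Rp, a₋) + H(Rp, Rn))`
  set H : Matrix ℕ ℕ ℂ := (Hk h ε ε : Matrix ℕ ℕ ℂ) with hHdef
  set H₀ : Matrix ℕ ℕ ℂ := hankelT (aPos V) (aNeg V) with hH₀
  set Rp : ℕ → ℂ := eP V ε - delta - (ε : ℂ) • aPos V with hRp
  set Rn : ℕ → ℂ := eN V ε - delta - (ε : ℂ) • aNeg V with hRn
  have hHu : H = hankelT (eP V ε - delta) (eN V ε - delta) := by
    rw [hHdef, coe_Hk]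
    exact hankelT_congr (fun n hn => by rw [Pi.sub_apply, delta_of_ne_zero (by omega), sub_zero])
      (fun n hn => by rw [Pi.sub_apply, delta_of_ne_zero (by omega), sub_zero])
  have hu_eq : eP V ε - delta = (ε : ℂ) • aPos V + Rp := (add_sub_cancel _ _).symm
  have hu'_eq : eN V ε - delta = (ε : ℂ) • aNeg V + Rn := (add_sub_cancel _ _).symm
  set Dm : Matrix ℕ ℕ ℂ := (ε : ℂ) • hankelT (aPos V) Rn + (ε : ℂ) • hankelT Rp (aNeg V) + hankelT Rp Rn
    with hDm
  have hdecomp : H = ((ε : ℂ) ^ 2) • H₀ + Dm := by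
    rw [hHu, hu_eq, hu'_eq, hankelT_add_left hεaP hR (hεaN.add hR') hσ.le hσ1,
      hankelT_add_right hεaP hεaN hR' hσ.le hσ1, hankelT_add_right hR hεaN hR' hσ.le hσ1,
      hankelT_smul_left, hankelT_smul_right, hankelT_smul_right, hankelT_smul_left, smul_smul, ← sq,
      hH₀, hDm]
    abel
  -- corner bounds for the pieces of `Dm`
  have hDc : IsCorner (tau r) (c1 V r * ε ^ 3) Dm := by
    have h1 := ((isCorner_hankelT_tau h haP hR').smul (ε : ℂ))
    have h2 := ((isCorner_hankelT_tau h hR haN).smul (ε : ℂ))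
    have h3 := isCorner_hankelT_tau h hR hR'
    rw [hnorm] at h1 h2
    refine ((h1.add h2).add h3).mono hτ ?_
    have hx : 0 ≤ wP V r ^ 2 * wN V r ^ 2 * hfac r := by positivity
    calc ε * (wP V r * (ε * wN V r) ^ 2 * hfac r) + ε * ((ε * wP V r) ^ 2 * wN V r * hfac r) +
          (ε * wP V r) ^ 2 * (ε * wN V r) ^ 2 * hfac r
        = ε ^ 3 * ((wP V r * wN V r ^ 2 + wP V r ^ 2 * wN V r) * hfac r) +
            ε ^ 4 * (wP V r ^ 2 * wN V r ^ 2 * hfac r) := by ring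
      _ ≤ ε ^ 3 * ((wP V r * wN V r ^ 2 + wP V r ^ 2 * wN V r) * hfac r) +
            ε ^ 3 * (wP V r ^ 2 * wN V r ^ 2 * hfac r) := by
          refine add_le_add le_rfl (mul_le_mul_of_nonneg_right ?_ hx)
          exact pow_le_pow_of_le_one hε hε1 (by norm_num)
      _ = c1 V r * ε ^ 3 := by rw [c1]; ring
  -- `H = O(ε²)`
  have hHc : IsCorner (tau r) (c2 V r * ε ^ 2) H := by
    rw [hHu]
    have := isCorner_hankelT_tau h hu hu'
    refine this.mono hτ (le_of_eq ?_)
    rw [c2]; ring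
  -- the perturbations `E₁ = X(-ε) - 1`, `E₂ = Y(-ε) - 1`
  set E₁ : Matrix ℕ ℕ ℂ := (X h (-(ε : ℂ)) : Matrix ℕ ℕ ℂ) - 1 with hE₁
  set E₂ : Matrix ℕ ℕ ℂ := (Y h (-(ε : ℂ)) : Matrix ℕ ℕ ℂ) - 1 with hE₂
  have hE₁r : IsRowDom (tau r) (2 * (ε * wP V r) * gconst r) E₁ := by
    have hg1 : IsGeom (sig r) (2 * (ε * wP V r)) (eP V (-(ε : ℂ)) - delta) := by
      have h1 := isGeom_expSeq_sub_delta ((isSumW_aPos h).smul (-(ε : ℂ))) hσ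
      rw [wn_smul, hnormn] at h1
      exact h1.mono hσ.le (exp_sub_one_le hε hwP hεP)
    have hD := isDom_lowerT hg1 hσ.le (tau r)
    have := hD.isRowDom (isWSeq_geomMajorant (tau_pos h) hσ.le (sig_lt_tau h) hg1.nonneg) (tau_pos h) hτ1
    rw [zero_div, add_zero, wnorm_geomMajorant] at this
    have hE₁' : E₁ = lowerT (eP V (-(ε : ℂ)) - delta) := by rw [hE₁, coe_X, lowerT_sub, lowerT_delta]
    rw [hE₁']
    exact this
  have hE₂c : IsColDom (tau r) (2 * (ε * wN V r) * gconst r) E₂ := by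
    have hg1 : IsGeom (sig r) (2 * (ε * wN V r)) (eN V (-(ε : ℂ)) - delta) := by
      have h1 := isGeom_expSeq_sub_delta ((isSumW_aNeg h).smul (-(ε : ℂ))) hσ
      rw [wn_smul, hnormn] at h1
      exact h1.mono hσ.le (exp_sub_one_le hε hwN hεN)
    have hD := isDom_upperT hg1 hσ.le (tau r)
    have := hD.isColDom (isWSeq_geomMajorant (tau_pos h) hσ.le (sig_lt_tau h) hg1.nonneg) (tau_pos h) hτ1
    rw [zero_div, add_zero, wnorm_geomMajorant] at this
    have hE₂' : E₂ = upperT (eN V (-(ε : ℂ)) - delta) := by rw [hE₂, coe_Y, upperT_sub, upperT_delta]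
    rw [hE₂']
    exact this
  -- `K = H + E₁ H + H E₂ + E₁ H E₂`
  set P : Matrix ℕ ℕ ℂ := imul E₁ H + imul H E₂ + imul (imul E₁ H) E₂ with hP
  have hK : K h ε ε = H + P := by
    have hring : X h (-(ε : ℂ)) * Hk h ε ε * Y h (-(ε : ℂ)) =
        Hk h ε ε + ((X h (-(ε : ℂ)) - 1) * Hk h ε ε + Hk h ε ε * (Y h (-(ε : ℂ)) - 1) +
          (X h (-(ε : ℂ)) - 1) * Hk h ε ε * (Y h (-(ε : ℂ)) - 1)) := by noncomm_ring
    rw [K, hring, DomMat.coe_add, DomMat.coe_add, DomMat.coe_add, DomMat.coe_mul, DomMat.coe_mul,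
      DomMat.coe_mul, DomMat.coe_mul, DomMat.coe_sub, DomMat.coe_sub, DomMat.coe_one, hP, hE₁, hE₂, hHdef]
  have hPc : IsCorner (tau r) (2 * (ε * wP V r) * gconst r * (c2 V r * ε ^ 2) +
      c2 V r * ε ^ 2 * (2 * (ε * wN V r) * gconst r) +
      2 * (ε * wP V r) * gconst r * (c2 V r * ε ^ 2) * (2 * (ε * wN V r) * gconst r)) P := by
    have h1 := hE₁r.imul_corner hHc hτ
    have h2 := hHc.imul_colDom hE₂c hτ
    have h3 := h1.imul_colDom hE₂c hτ
    exact (h1.add h2).add h3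
  have hc2 := c2_nonneg h
  constructor
  · -- `K = O(ε²)`
    rw [hK]
    refine (hHc.add hPc).mono hτ ?_
    have hx1 : 0 ≤ c2 V r * (2 * wP V r * gconst r + 2 * wN V r * gconst r) := by positivity
    have hx2 : 0 ≤ c2 V r * (4 * wP V r * wN V r * gconst r ^ 2) := by positivity
    calc c2 V r * ε ^ 2 + (2 * (ε * wP V r) * gconst r * (c2 V r * ε ^ 2) +
          c2 V r * ε ^ 2 * (2 * (ε * wN V r) * gconst r) +
          2 * (ε * wP V r) * gconst r * (c2 V r * ε ^ 2) * (2 * (ε * wN V r) * gconst r))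
        = c2 V r * ε ^ 2 + ε ^ 3 * (c2 V r * (2 * wP V r * gconst r + 2 * wN V r * gconst r)) +
            ε ^ 4 * (c2 V r * (4 * wP V r * wN V r * gconst r ^ 2)) := by ring
      _ ≤ c2 V r * ε ^ 2 + ε ^ 2 * (c2 V r * (2 * wP V r * gconst r + 2 * wN V r * gconst r)) +
            ε ^ 2 * (c2 V r * (4 * wP V r * wN V r * gconst r ^ 2)) := by
          refine add_le_add (add_le_add le_rfl (mul_le_mul_of_nonneg_right ?_ hx1))
            (mul_le_mul_of_nonneg_right ?_ hx2)
          · exact pow_le_pow_of_le_one hε hε1 (by norm_num)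
          · exact pow_le_pow_of_le_one hε hε1 (by norm_num)
      _ = c4 V r * ε ^ 2 := by rw [c4]; ring
  · -- `K - ε² H₀ = O(ε³)`
    have heq : K h ε ε - ((ε : ℂ) ^ 2) • hankelT (aPos V) (aNeg V) = Dm + P := by
      rw [hK, hdecomp, hH₀]; abel
    rw [heq]
    refine (hDc.add hPc).mono hτ ?_
    have hx1 : 0 ≤ c2 V r * (2 * wP V r * gconst r + 2 * wN V r * gconst r) := by positivity
    have hx2 : 0 ≤ c2 V r * (4 * wP V r * wN V r * gconst r ^ 2) := by positivity
    calc c1 V r * ε ^ 3 + (2 * (ε * wP V r) * gconst r * (c2 V r * ε ^ 2) +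
          c2 V r * ε ^ 2 * (2 * (ε * wN V r) * gconst r) +
          2 * (ε * wP V r) * gconst r * (c2 V r * ε ^ 2) * (2 * (ε * wN V r) * gconst r))
        = c1 V r * ε ^ 3 + ε ^ 3 * (c2 V r * (2 * wP V r * gconst r + 2 * wN V r * gconst r)) +
            ε ^ 4 * (c2 V r * (4 * wP V r * wN V r * gconst r ^ 2)) := by ring
      _ ≤ c1 V r * ε ^ 3 + ε ^ 3 * (c2 V r * (2 * wP V r * gconst r + 2 * wN V r * gconst r)) +
            ε ^ 3 * (c2 V r * (4 * wP V r * wN V r * gconst r ^ 2)) :=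
          add_le_add le_rfl (mul_le_mul_of_nonneg_right (pow_le_pow_of_le_one hε hε1 (by norm_num)) hx2)
      _ = c3 V r * ε ^ 3 := by rw [c3]; ring

/-- **The second-order expansion `f ε ε = 1 + ε² κ + O(ε³)`**: for real `0 < ε ≤ eps0`,
`‖f ε ε - 1 - ε² κ(V)‖ ≤ Acst · ε³` (`det (1 + K) = 1 + tr K + O(‖K‖²)`, `K = ε² H₀ + O(ε³)`,
`tr H₀ = κ`). [folklore] -/
theorem norm_f_sub_le (h : IsGeomSymbol V Cv r) {ε : ℝ} (hε : 0 < ε) (hε0 : ε ≤ eps0 V r) :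
    ‖f h ε ε - 1 - (ε : ℂ) ^ 2 * kappa V‖ ≤ Acst V r * ε ^ 3 := by
  have hτ := (tau_pos h).le; have hτ1 := tau_lt_one h
  obtain ⟨hKc, hDc⟩ := isCorner_K_eps h hε.le hε0
  have hε1 : ε ≤ 1 := hε0.trans (min_le_left _ _)
  have hc4 := c4_nonneg h
  -- `c4 ε² ≤ 1`
  have hsmall : c4 V r * ε ^ 2 ≤ 1 := by
    have h2 : ε ≤ 1 / (c4 V r + 1) := hε0.trans ((min_le_right _ _).trans (min_le_right _ _))
    rw [le_div_iff₀ (by positivity)] at h2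
    nlinarith [sq_nonneg ε, mul_nonneg hc4 hε.le]
  have hH₀c : IsCorner (tau r) (wP V r * wN V r * hfac r) (hankelT (aPos V) (aNeg V)) :=
    isCorner_hankelT_tau h ((isSumW_aPos h).isGeom (sig_pos h)) ((isSumW_aNeg h).isGeom (sig_pos h))
  -- the determinant expansion
  have h1 := norm_detOnePlus_sub_one_sub_ctrace_le hKc hτ hτ1 hsmall
  -- the trace
  have htr : ctrace (K h ε ε) - (ε : ℂ) ^ 2 * kappa V = ctrace (K h ε ε - ((ε : ℂ) ^ 2) • hankelT (aPos V) (aNeg V)) := by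
    rw [ctrace_sub hKc (hH₀c.smul _) hτ hτ1, ctrace_smul, ctrace_hankelT_eq_kappa h]
  have h2 : ‖ctrace (K h ε ε) - (ε : ℂ) ^ 2 * kappa V‖ ≤ c3 V r * ε ^ 3 / (1 - tau r ^ 2) := by
    rw [htr]; exact norm_ctrace_le hDc hτ hτ1
  have hkB : 0 ≤ kochConst (tau r) 1 * ∑' S, kochWeight (tau r) S :=
    mul_nonneg (kochConst_nonneg _ _) (tsum_nonneg fun S => kochWeight_nonneg hτ S)
  calc ‖f h ε ε - 1 - (ε : ℂ) ^ 2 * kappa V‖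
      = ‖(detOnePlus (K h ε ε) - 1 - ctrace (K h ε ε)) + (ctrace (K h ε ε) - (ε : ℂ) ^ 2 * kappa V)‖ := by
        rw [f]; congr 1; ring
    _ ≤ ‖detOnePlus (K h ε ε) - 1 - ctrace (K h ε ε)‖ + ‖ctrace (K h ε ε) - (ε : ℂ) ^ 2 * kappa V‖ :=
        norm_add_le _ _
    _ ≤ kochConst (tau r) 1 * (∑' S, kochWeight (tau r) S) * (c4 V r * ε ^ 2) ^ 2 +
          c3 V r * ε ^ 3 / (1 - tau r ^ 2) := add_le_add h1 h2
    _ = ε ^ 4 * (kochConst (tau r) 1 * (∑' S, kochWeight (tau r) S) * c4 V r ^ 2) +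
          ε ^ 3 * (c3 V r / (1 - tau r ^ 2)) := by ring
    _ ≤ ε ^ 3 * (kochConst (tau r) 1 * (∑' S, kochWeight (tau r) S) * c4 V r ^ 2) +
          ε ^ 3 * (c3 V r / (1 - tau r ^ 2)) :=
        add_le_add (mul_le_mul_of_nonneg_right (pow_le_pow_of_le_one hε.le hε1 (by norm_num))
          (mul_nonneg hkB (sq_nonneg _))) le_rfl
    _ = Acst V r * ε ^ 3 := by rw [Acst]; ring

end Expansion

/-! ### The limit `(1 + κ/N + o(1/N))^N → e^κ` -/

/-- **Exponential limit**: if `N_m → ∞` and `N_m (z_m - 1) → κ` then `z_m^{N_m} → e^κ` (complex;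
through `N log z = N(z-1) + N·O(|z-1|²)`). [folklore] -/
theorem tendsto_pow_exp_of_tendsto {z : ℕ → ℂ} {N : ℕ → ℕ} {κ : ℂ} (hN : Tendsto N atTop atTop)
    (hz : Tendsto (fun m => (N m : ℂ) * (z m - 1)) atTop (𝓝 κ)) :
    Tendsto (fun m => z m ^ N m) atTop (𝓝 (Complex.exp κ)) := by
  set u : ℕ → ℂ := fun m => z m - 1 with hu
  -- `u → 0`
  have hNC : Tendsto (fun m => (N m : ℝ)) atTop atTop := tendsto_natCast_atTop_atTop.comp hN
  have hu0 : Tendsto u atTop (𝓝 0) := by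
    have hinv : Tendsto (fun m => ((N m : ℝ))⁻¹) atTop (𝓝 0) := hNC.inv_tendsto_atTop
    have hinvC : Tendsto (fun m => ((N m : ℂ))⁻¹) atTop (𝓝 0) := by
      have := (Complex.continuous_ofReal.tendsto 0).comp hinv
      simp only [Function.comp_def, Complex.ofReal_zero] at this
      refine this.congr fun m => ?_
      push_cast; rfl
    have hprod := hinvC.mul hz
    rw [zero_mul] at hprod
    refine hprod.congr' ?_
    filter_upwards [hN.eventually (eventually_ge_atTop 1)] with m hm
    have hne : (N m : ℂ) ≠ 0 := by exact_mod_cast (by omega : N m ≠ 0)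
    rw [hu]; field_simp
  -- eventually `‖u‖ < 1/2`
  have hsmall : ∀ᶠ m in atTop, ‖u m‖ < 1 / 2 := by
    have := (tendsto_zero_iff_norm_tendsto_zero.1 hu0).eventually (gt_mem_nhds (by norm_num : (0:ℝ) < 1/2))
    exact this
  -- `N (log (1+u) - u) → 0`
  have hcorr : Tendsto (fun m => (N m : ℂ) * (Complex.log (1 + u m) - u m)) atTop (𝓝 0) := by
    rw [tendsto_zero_iff_norm_tendsto_zero]
    have hbound : ∀ᶠ m in atTop, ‖(N m : ℂ) * (Complex.log (1 + u m) - u m)‖ ≤ ‖(N m : ℂ) * u m‖ * ‖u m‖ := by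
      filter_upwards [hsmall] with m hm
      have hm1 : ‖u m‖ < 1 := hm.trans (by norm_num)
      have hlog := Complex.norm_log_one_add_sub_self_le hm1
      rw [norm_mul, norm_mul, mul_assoc]
      refine mul_le_mul_of_nonneg_left (hlog.trans ?_) (norm_nonneg _)
      -- `‖u‖² (1-‖u‖)⁻¹/2 ≤ ‖u‖ ‖u‖` since `(1 - ‖u‖)⁻¹ ≤ 2`
      have h1 : (1 - ‖u m‖)⁻¹ ≤ 2 := by
        rw [inv_le_comm₀ (by linarith) (by norm_num)]; linarith
      have h2 : 0 ≤ ‖u m‖ ^ 2 := sq_nonneg _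
      calc ‖u m‖ ^ 2 * (1 - ‖u m‖)⁻¹ / 2 ≤ ‖u m‖ ^ 2 * 2 / 2 :=
            div_le_div_of_nonneg_right (mul_le_mul_of_nonneg_left h1 h2) (by norm_num)
        _ = ‖u m‖ * ‖u m‖ := by ring
    have hlim : Tendsto (fun m => ‖(N m : ℂ) * u m‖ * ‖u m‖) atTop (𝓝 0) := by
      have := (tendsto_norm.comp hz).mul (tendsto_zero_iff_norm_tendsto_zero.1 hu0)
      rw [mul_zero] at this
      exact this
    exact squeeze_zero' (Eventually.of_forall fun m => norm_nonneg _) hbound hlim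
  -- `N log (1+u) → κ`
  have hlog : Tendsto (fun m => (N m : ℂ) * Complex.log (1 + u m)) atTop (𝓝 κ) := by
    have := hz.add hcorr
    rw [add_zero] at this
    refine this.congr fun m => ?_
    ring
  -- exponentiate
  have hexp := (Complex.continuous_exp.tendsto κ).comp hlog
  refine hexp.congr' ?_
  filter_upwards [hsmall] with m hm
  have hne : 1 + u m ≠ 0 := by
    intro h0
    have : ‖u m‖ = 1 := by
      have : u m = -1 := by linear_combination h0
      rw [this, norm_neg, norm_one]
    linarith
  rw [Function.comp_apply, Complex.exp_nat_mul, Complex.exp_log hne, hu]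
  simp

/-! ### The value `f 1 1 = e^κ` -/

section Final

variable {V : ℝ → ℂ} {Cv r : ℝ}

/-- **`f 1 1 = e^{κ(V)}`** (bicharacter + second-order expansion + the exponential limit along
`ε = 2^{-m}`, `N = 4^m`). [folklore] -/
theorem f_one_one_eq_exp (h : IsGeomSymbol V Cv r) [Fact (0 ≤ r)] [Fact (r < 1)] :
    f h 1 1 = Complex.exp (kappa V) := by
  set ε : ℕ → ℝ := fun m => ((2 : ℝ) ^ m)⁻¹ with hεdef
  have hεC : ∀ m : ℕ, ((ε m : ℝ) : ℂ) = (2 : ℂ) ^ (-(m : ℤ)) := by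
    intro m; rw [hεdef, _root_.zpow_neg, zpow_natCast]; push_cast; rfl
  set z : ℕ → ℂ := fun m => f h (ε m) (ε m) with hz
  have hconst : ∀ m, f h 1 1 = z m ^ (4 ^ m) := fun m => by
    rw [hz]; simp only; rw [hεC]; exact f_one_one_eq_pow h m
  have hεpos : ∀ m, 0 < ε m := fun m => by rw [hεdef]; positivity
  have htend0 : Tendsto ε atTop (𝓝 0) :=
    tendsto_inv_atTop_zero.comp (tendsto_pow_atTop_atTop_of_one_lt one_lt_two)
  have hev : ∀ᶠ m in atTop, ε m ≤ eps0 V r := htend0.eventually (eventually_le_nhds (eps0_pos h))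
  -- `4^m ε_m² = 1`
  have h4 : ∀ m : ℕ, ((4 ^ m : ℕ) : ℂ) * ((ε m : ℝ) : ℂ) ^ 2 = 1 := by
    intro m
    rw [hεdef]; push_cast
    rw [show (4 : ℂ) ^ m = (2 ^ m) ^ 2 by rw [← pow_mul, mul_comm, pow_mul]; norm_num]
    field_simp
  have h4r : ∀ m : ℕ, (4 : ℝ) ^ m * ε m ^ 3 = ε m := by
    intro m
    rw [hεdef]; simp only
    rw [show (4 : ℝ) ^ m = (2 ^ m) ^ 2 by rw [← pow_mul, mul_comm, pow_mul]; norm_num]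
    field_simp
  -- the key estimate `‖4^m (z_m - 1) - κ‖ ≤ Acst ε_m`
  have hkey : ∀ᶠ m in atTop, ‖((4 ^ m : ℕ) : ℂ) * (z m - 1) - kappa V‖ ≤ Acst V r * ε m := by
    filter_upwards [hev] with m hm
    have hb := norm_f_sub_le h (hεpos m) hm
    have heq : ((4 ^ m : ℕ) : ℂ) * (z m - 1) - kappa V =
        ((4 ^ m : ℕ) : ℂ) * (f h (ε m) (ε m) - 1 - ((ε m : ℝ) : ℂ) ^ 2 * kappa V) := by
      have := h4 m
      rw [hz]; simp only
      linear_combination (kappa V) * this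
    rw [heq, norm_mul]
    have hn4 : ‖((4 ^ m : ℕ) : ℂ)‖ = (4 : ℝ) ^ m := by
      rw [Complex.norm_natCast]; push_cast; rfl
    rw [hn4]
    calc (4 : ℝ) ^ m * ‖f h (ε m) (ε m) - 1 - ((ε m : ℝ) : ℂ) ^ 2 * kappa V‖
        ≤ (4 : ℝ) ^ m * (Acst V r * ε m ^ 3) := mul_le_mul_of_nonneg_left hb (by positivity)
      _ = Acst V r * ((4 : ℝ) ^ m * ε m ^ 3) := by ring
      _ = Acst V r * ε m := by rw [h4r]
  have hz1 : Tendsto (fun m => ((4 ^ m : ℕ) : ℂ) * (z m - 1)) atTop (𝓝 (kappa V)) := by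
    rw [tendsto_iff_norm_sub_tendsto_zero]
    refine squeeze_zero' (Eventually.of_forall fun m => norm_nonneg _) hkey ?_
    simpa using htend0.const_mul (Acst V r)
  have hN : Tendsto (fun m : ℕ => 4 ^ m) atTop atTop := tendsto_pow_atTop_atTop_of_one_lt (by norm_num)
  have hlim := tendsto_pow_exp_of_tendsto hN hz1
  have hc : Tendsto (fun m => z m ^ (4 ^ m)) atTop (𝓝 (f h 1 1)) :=
    tendsto_const_nhds.congr fun m => hconst m
  exact tendsto_nhds_unique hc hlim

end Final

end Szego

/-! ### The theorem -/

/-- **The strong Szegő limit theorem for symbols with geometrically decaying logarithm**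
(Deift–Its–Krasovsky 2013, §3, Theorem 7 / eq. (31), in the form of the tree's named fact
`strongSzego`, restricted to geometric decay): if `V : ℝ → ℂ` is continuous, `2π`-periodic and
`‖circleCoeff V k‖ ≤ C r^{|k|}` with `0 ≤ r < 1`, then
`D_n(e^V) / exp (n V₀) → exp (∑_{k ≥ 1} k V_k V_{-k})`. [cite: DeiftItsKrasovsky2013, §3, Theorem 7] -/
theorem strongSzego_geometric {V : ℝ → ℂ} (hV : Continuous V) (hper : Function.Periodic V (2 * Real.pi))
    {C r : ℝ} (hr : 0 ≤ r) (hr1 : r < 1) (hcoeff : ∀ k, ‖circleCoeff V k‖ ≤ C * r ^ k.natAbs) :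
    Tendsto (fun n : ℕ => toeplitzDet (circleCoeff fun θ => Complex.exp (V θ)) n /
        Complex.exp (n * circleCoeff V 0)) atTop
      (𝓝 (Complex.exp (∑' k : ℕ, ((k : ℂ) + 1) * circleCoeff V ((k : ℤ) + 1) *
        circleCoeff V (-((k : ℤ) + 1))))) := by
  have h : Szego.IsGeomSymbol V C r := ⟨hV, hper, hcoeff, hr, hr1⟩
  haveI : Fact (0 ≤ r) := ⟨hr⟩
  haveI : Fact (r < 1) := ⟨hr1⟩
  have hmain := Szego.tendsto_toeplitzDet_div h
  rw [Szego.f_one_one_eq_exp h] at hmain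
  exact hmain

end Literature.Analysis.Toeplitz
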